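import Summits.Langlands.Langlands.Theses.DyadicCompanionSplit

/-!
# Glue of the layer-2 split of `DyadicCompanionExistence` (route DyadicCompanionSplit)

Closes the glue item of `route-Langlands-DyadicCompanionSplit` generated by
`--split DyadicCompanionExistence --glue-decl-name DyadicCompanionExistence_of_split`:
`DyadicCompanionExistence_of_split : DyadicContinuousCompanion → DyadicDeRhamRigidity → DyadicCompanionExistence`.
Two lines of logic over the inlined texts: T supplies the continuous a.e.-unramified matched ρ₂, G makes it de Rham above 2.
(= lens-4 g8 node `DyadicRigiditySplit.dyadicCompanionExistence_of_TG` / module `LevelOneDyadic.dyadicCompanionExistence_of_TG`; mock-certified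
against the gate render in `split_glue.mock.lean`, rc 0.)  No definitions, no new mathematics.
-/

set_option linter.dupNamespace false

namespace Summit.Langlands.Langlands.Theorems

/-- The glue item of the split of `DyadicCompanionSplit.DyadicCompanionExistence`: T → G → E. -/
theorem DyadicCompanionExistence_of_split_proof :
    Summit.Langlands.Langlands.Theses.DyadicCompanionSplit.DyadicCompanionExistence_of_split := by
  intro hT hG K _ _ n hn ℓ _ hℓ2 ι ρ hirr hgeo hcrys hlev ι₂
  obtain ⟨ρ₂, hur₂, hm⟩ := hT K n hn ℓ hℓ2 ι ρ hirr hgeo hcrys hlev ι₂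
  exact ⟨ρ₂, ⟨hur₂, hG K n hn ℓ hℓ2 ι ρ hirr hgeo hcrys hlev ι₂ ρ₂ hur₂ hm⟩, hm⟩

end Summit.Langlands.Langlands.Theorems
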